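import Summits.QuantumFields.YangMills.Theorems.BalabanUVNodesN18AvgPotentialCombGauge
import Literature.MathematicalPhysics.QuantumFieldTheory.Balaban1983to89.B12GaugeFixInvariance269

/-!
# BalabanUVNodes ∕ node N18 = NE5 — closure-ledger item (iii), (β3) AT THE CHART LEVEL, LOCAL EDITION: the double-bar letters of `…N18AvgPotentialCombGauge` WITH
# HYPOTHESES ONLY ON THE TWO-BLOCK READ SETS `B(c₋) ∪ B(c₊)` (and `B(c′₋) ∪ B(c′₊)` for the coarse difference) — the form a CUBE-LOCAL (1.12) clause supplies
# (Track A, DAG node N18 = `T4OutputRate.NE5` :211; cluster K4 «SpineRates», item K3⁷ `SpineGivenEndpointR13SepCoPH`; WIDTH SEAT pub-ymgap-dag-n18-w3 g2, file 4)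

HONEST FRAMING.  Count-neutral kernel bookkeeping (`--supports stmt-QuantumFields-20544 --as helper`); elementary, PROVED by the CUTOFF TRICK: a field agreeing with
the given one on the read set and trivial (`U = 1`, `A = 0`) elsewhere satisfies the GLOBAL hypotheses of file 3b with the LOCAL constants, and every object of the
double bar — the (0.4) average (`T4ReflectionConeSharp.avgFun_congr₂`, the tree's «(0.4) IS TWO-BLOCK LOCAL»), the comb means (staircases stay in their block,
`BlockAveragingTwoLevel`'s `blockOf_ends_of_mem_stairWalk`), the straight block average (`B5AveragingLocalityV1.runBond_blockSite_local`) — reads only the two blocks.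
For the coarse difference a second cutoff transplants the `L·e_ν`-translate onto the read set of `c` (blocks go to blocks, `B12GaugeFixInvariance269.blockOf_add_scale`).
NE5 is NOT PRINTED and NOT proved; N18 is NOT discharged; the transport clause `hT₀`∕`hTsp` is NOT discharged here.

WHY.  [Balaban1987RG1] (1.12) is a clause PER CUBE `□` of size `O(1)LM`: the gauge `u` and the potential `A` with `U^u = exp iξA`, `|A|, |∇^ξA| < O(1)LMBα₀` are given ON
`□` ONLY.  File 3b's letters carry global sup hypotheses (`‖A_b‖ ≤ r` on the whole torus); this file removes that: the double-bar potential at a coarse bond `c` and its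
coarse unit difference towards `c′ = c + e_ν` are controlled by `A` on the fine bonds with both ends in `B(c₋) ∪ B(c₊)` (resp. also `B(c′₋) ∪ B(c′₊)`), which lie inside
the fine cube over any coarse cube containing `c, c′` (dag-n18-d 19c `regionOfSet_preimage_mem_cubesI_succ` ∕ `runBond_blockSite_mem_bonds_preimage`).  The `L·e_ν`-difference
hypothesis `‖A(b + Le_ν) − A(b)‖ ≤ ρ_L` on the read set of `c` is what the cube's `∇^ξ`-letter gives by telescoping inside the cube (`ρ_L = L·ξ·sup_□|∇^ξ_νA|`; §3's
`norm_translate_sub_le_of_steps` telescopes along a caller-supplied bond set).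

WHAT (objects as in file 3b; `V(c) = exp(−iξλ̄_A(c₋))·Ū(c)·exp(iξλ̄_A(c₊))`; regime `48ℓξr ≤ 1`, `4ℓξr < δ_N`; standing range `j + 1 ≤ m + K`).
* §1 locality: `walkSum_congr`, `combMean_congr_block`, `bondAvg_congr₂`, `bondAvg_translate_shift`.
* §2 ★ `norm_mlog_combConj_sub_le_local` (C⁰ `2000·ℓ²ξ²r²` from the two blocks of `c`).
* §3 `blockOf_translate_L_shift` (blocks go to blocks), ★ `norm_mlog_combConj_rem_shift_sub_le_local` (coarse unit difference `3200·ℓ²ξ²r·ρ_L` from the blocks of `c, c′` and the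
  `Le_ν`-differences on the blocks of `c`), `norm_translate_sub_le_of_steps` (`ρ_L = L·r₁` by telescoping along a caller-supplied bond set `T` holding the `L` unit steps from
  the read set — the caller's cube).
* §4 ★ `norm_mlog_combConj_le_local` (SUP letter), ★ `norm_shift_sub_mlog_combConj_le_local` (COARSE-DIFFERENCE letter) — file 3b §3 with local hypotheses.

WHAT THIS IS NOT.  Not the `Sect2.CondI`∕`cubesI` packaging (the caller maps «both ends in the blocks of `c, c′`» into «bond of the fine cube» with 19c); not (T1)–(T3);
finite tori at fixed `ε` — not continuum ∕ OS ∕ mass gap ∕ Clay.  0 `def`, 0 `sorry`, standard axioms.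
-/

open scoped BigOperators

namespace YMDAG.N18.AvgPotential

open NormedSpace (exp)
open Literature.MathematicalPhysics.QuantumFieldTheory.Balaban1983to89
open Literature.MathematicalPhysics.QuantumFieldTheory.Balaban1983to89.T4Continuum
open Literature.MathematicalPhysics.QuantumFieldTheory.Balaban1983to89.BlockAveraging
open Literature.MathematicalPhysics.QuantumFieldTheory.Balaban1983to89.LatticeFieldCalculus (bondAvg runBond runSite segSum)
open Literature.MathematicalPhysics.QuantumFieldTheory.Balaban1983to89.ExpMeanLog (deltaSU expMeanLogSU)
open Literature.MathematicalPhysics.QuantumFieldTheory.Balaban1983to89.MatrixLog (mlog)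
open Literature.MathematicalPhysics.QuantumFieldTheory.Balaban1983to89.BlockAveragingEMLLinearised (walkSum walkSum_cons walkSum_nil combMean combMean_def)
open Literature.MathematicalPhysics.QuantumFieldTheory.Balaban1983to89.T4ReflectionConeSharp (avgFun_congr₂)
open Literature.MathematicalPhysics.QuantumFieldTheory.Balaban1983to89.B5AveragingLocalityV1 (runBond_blockSite_local)
open Literature.MathematicalPhysics.QuantumFieldTheory.Balaban1983to89.B12GaugeFixInvariance269 (blockOf_add_scale)
open YMDAG.N18.HolonomyLipschitz (avgFun_translate_apply)
open YMDAG.N18.CondIKRow (norm_bondAvg_le_of_forall_run norm_bondAvg_shift_sub_le_of_forall_run)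
open Summit.QuantumFields.YangMills.Theorems.Prop7LinAvgOnto (norm_combMean_le)

open scoped Matrix.Norms.L2Operator

variable {n : Type*} [Fintype n] [DecidableEq n] [Nonempty n] {P : Params} {j : ℕ}

/-! ## §1 Locality of the letters of the double bar: two-block read sets -/

section Locality

omit [Fintype n] [DecidableEq n] [Nonempty n] in
/-- A signed walk sum depends only on the field on the bonds of the walk. [folklore] -/
theorem walkSum_congr {V : Type*} [AddCommGroup V] {A A' : PBond P j → V} {γ : List (LStep P j)} (h : ∀ s ∈ γ, A s.bond = A' s.bond) :
    walkSum A γ = walkSum A' γ := by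
  unfold walkSum
  rw [List.map_congr_left fun s hs => by rw [h s hs]]

omit [Fintype n] [DecidableEq n] [Nonempty n] in
/-- **The comb mean `λ̄_A(y)` reads only the bonds with both ends in `B(y)`** (staircases of (0.3) stay in their block, `blockOf_ends_of_mem_stairWalk`).
[cite: Balaban1987RG1, (0.3) p.252; Balaban1985Averaging, (62) p.28] -/
theorem combMean_congr_block (hj : j + 1 ≤ P.m + P.K) {A A' : PBond P j → Matrix n n ℂ} (y : Site P (j + 1))
    (h : ∀ b : PBond P j, blockOf b.src = y → blockOf b.tgt = y → A b = A' b) : combMean A y = combMean A' y := by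
  rw [combMean_def, combMean_def]
  congr 1
  refine Finset.sum_congr rfl fun i _ => walkSum_congr fun s hs => ?_
  have hb := blockOf_ends_of_mem_stairWalk hj y i.1 i.2.1 s hs
  exact h s.bond hb.1 hb.2

omit [Fintype n] [DecidableEq n] [Nonempty n] in
/-- **The straight block average `(QA)(c)` reads only the bonds with both ends in `B(c₋) ∪ B(c₊)`** (`runBond_blockSite_local`). [cite: Balaban1984PropagatorsI, (1.11) p.19] -/
theorem bondAvg_congr₂ (hj : j + 1 ≤ P.m + P.K) {A A' : PBond P j → Matrix n n ℂ} (c : PBond P (j + 1))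
    (h : ∀ b : PBond P j, (blockOf b.src = c.src ∨ blockOf b.src = c.tgt) → (blockOf b.tgt = c.src ∨ blockOf b.tgt = c.tgt) → A b = A' b) :
    bondAvg A c = bondAvg A' c := by
  unfold bondAvg segSum
  congr 1
  refine Finset.sum_congr rfl fun r _ => Finset.sum_congr rfl fun t ht => ?_
  have hl := runBond_blockSite_local hj c r (Finset.mem_range.mp ht)
  exact h _ hl.1 hl.2

omit [Fintype n] [DecidableEq n] [Nonempty n] in
/-- **The straight block average is translation-covariant**: `Q(A∘τ_{Le_ν})(⟨y, μ⟩) = (QA)(⟨y + e_ν, μ⟩)` — read off `Q₁ = L·Q − dλ̄` for both fields (file 2's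
`linAvg_translate_shift`, file 3a's `combMean_translate_shift`). [cite: Balaban1984PropagatorsI, (1.11) p.19; Balaban1987RG1, (2.17) p.269] -/
theorem bondAvg_translate_shift (A : PBond P j → Matrix n n ℂ) (y : Site P (j + 1)) (μ ν : Fin P.d) :
    bondAvg (fun b => A (b.translate (P.L • (0 : Site P j).shift ν))) ⟨y, μ⟩ = bondAvg A ⟨y.shift ν, μ⟩ := by
  set A' : PBond P j → Matrix n n ℂ := fun b => A (b.translate (P.L • (0 : Site P j).shift ν)) with hA'
  have h1 := BlockAveragingEMLLinearised.linAvg_eq_bondAvg_sub_grad_combMean A (⟨y.shift ν, μ⟩ : PBond P (j + 1))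
  have h2 := BlockAveragingEMLLinearised.linAvg_eq_bondAvg_sub_grad_combMean A' (⟨y, μ⟩ : PBond P (j + 1))
  have hl : BlockAveragingEMLLinearised.linAvg A ⟨y.shift ν, μ⟩ = BlockAveragingEMLLinearised.linAvg A' ⟨y, μ⟩ := by rw [hA', linAvg_translate_shift]
  have hsrc : combMean A (y.shift ν) = combMean A' y := by rw [hA', combMean_translate_shift]
  have htgt : combMean A ((y.shift ν).shift μ) = combMean A' (y.shift μ) := by rw [hA', combMean_translate_shift, Site.shift_comm]
  change BlockAveragingEMLLinearised.linAvg A ⟨y.shift ν, μ⟩ =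
    ((P.L : ℕ) : ℂ) • bondAvg A ⟨y.shift ν, μ⟩ - (combMean A ((y.shift ν).shift μ) - combMean A (y.shift ν)) at h1
  change BlockAveragingEMLLinearised.linAvg A' ⟨y, μ⟩ = ((P.L : ℕ) : ℂ) • bondAvg A' ⟨y, μ⟩ - (combMean A' (y.shift μ) - combMean A' y) at h2
  rw [hl, h2, ← hsrc, ← htgt] at h1
  have hL : ((P.L : ℕ) : ℂ) ≠ 0 := Nat.cast_ne_zero.mpr P.L_pos.ne'
  have h3 : ((P.L : ℕ) : ℂ) • bondAvg A' ⟨y, μ⟩ = ((P.L : ℕ) : ℂ) • bondAvg A ⟨y.shift ν, μ⟩ := sub_left_injective h1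
  exact smul_right_injective (Matrix n n ℂ) hL h3

end Locality

/-! ## §2 The C⁰ letter from the two blocks of `c` -/

section LocalCZero

/-- ★ **PROP. 3 IN THE COMB GAUGE, C⁰, LOCAL**: if `U_b = exp(iξA_b)` and `‖A_b‖ ≤ r` hold ON THE BONDS WITH BOTH ENDS IN `B(c₋) ∪ B(c₊)` (`48ℓξr ≤ 1`, `4ℓξr < δ_N`), then
`‖log V(c) − iξ′·(QA)(c)‖ ≤ 2000·ℓ²ξ²r²` — file 3b's `norm_mlog_combConj_sub_le` at the cutoff pair (`U` on the read set, `1` elsewhere; `A` on the read set, `0` elsewhere),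
every object of the double bar reading only the two blocks. [cite: Balaban1985Averaging, (62)-(63) p.28, (93) p.32, Prop. 3 (121)-(123) p.36; Balaban1987RG1, (0.4) p.253 and (1.12) p.262] -/
theorem norm_mlog_combConj_sub_le_local (hj : j + 1 ≤ P.m + P.K) (U : GaugeField P j (Matrix.specialUnitaryGroup n ℂ)) (A : PBond P j → Matrix n n ℂ)
    (c : PBond P (j + 1)) {ξ r : ℝ} (hξ : 0 ≤ ξ) (hr : 0 ≤ r)
    (hUA : ∀ b : PBond P j, (blockOf b.src = c.src ∨ blockOf b.src = c.tgt) → (blockOf b.tgt = c.src ∨ blockOf b.tgt = c.tgt) →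
      ((U b : Matrix.specialUnitaryGroup n ℂ) : Matrix n n ℂ) = exp ((Complex.I * ξ : ℂ) • A b))
    (hA : ∀ b : PBond P j, (blockOf b.src = c.src ∨ blockOf b.src = c.tgt) → (blockOf b.tgt = c.src ∨ blockOf b.tgt = c.tgt) → ‖A b‖ ≤ r)
    (h48 : 48 * ((((P.d + 2) * P.L : ℕ) : ℝ) * (ξ * r)) ≤ 1) (hN : 4 * ((((P.d + 2) * P.L : ℕ) : ℝ) * (ξ * r)) < deltaSU n) :
    ‖mlog (exp ((Complex.I * ξ : ℂ) • (-combMean A c.src)) * (((avgFun (expMeanLogSU (n := n)) U c : Matrix.specialUnitaryGroup n ℂ) : Matrix n n ℂ)) *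
          exp ((Complex.I * ξ : ℂ) • combMean A c.tgt)) - (Complex.I * ξ * P.L : ℂ) • bondAvg A c‖ ≤
      2000 * (((P.d + 2) * P.L : ℕ) : ℝ) ^ 2 * ξ ^ 2 * r ^ 2 := by
  classical
  -- the cutoff pair
  set R : PBond P j → Prop := fun b => (blockOf b.src = c.src ∨ blockOf b.src = c.tgt) ∧ (blockOf b.tgt = c.src ∨ blockOf b.tgt = c.tgt) with hR
  set U0 : GaugeField P j (Matrix.specialUnitaryGroup n ℂ) := fun b => if R b then U b else 1 with hU0
  set A0 : PBond P j → Matrix n n ℂ := fun b => if R b then A b else 0 with hA0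
  have hUA0 : ∀ b, ((U0 b : Matrix.specialUnitaryGroup n ℂ) : Matrix n n ℂ) = exp ((Complex.I * ξ : ℂ) • A0 b) := by
    intro b
    by_cases hb : R b
    · simp only [hU0, hA0, if_pos hb]; exact hUA b hb.1 hb.2
    · simp only [hU0, hA0, if_neg hb, smul_zero, NormedSpace.exp_zero]; rfl
  have hA0r : ∀ b, ‖A0 b‖ ≤ r := by
    intro b
    by_cases hb : R b
    · simp only [hA0, if_pos hb]; exact hA b hb.1 hb.2
    · simp only [hA0, if_neg hb, norm_zero]; exact hr
  -- the double bar of the cutoff pair IS the double bar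
  have hUU0 : ∀ b : PBond P j, (blockOf b.src = c.src ∨ blockOf b.src = c.tgt) → (blockOf b.tgt = c.src ∨ blockOf b.tgt = c.tgt) → U b = U0 b :=
    fun b h1 h2 => by simp only [hU0, if_pos (show R b from ⟨h1, h2⟩)]
  have hAA0 : ∀ b : PBond P j, (blockOf b.src = c.src ∨ blockOf b.src = c.tgt) → (blockOf b.tgt = c.src ∨ blockOf b.tgt = c.tgt) → A b = A0 b :=
    fun b h1 h2 => by simp only [hA0, if_pos (show R b from ⟨h1, h2⟩)]
  have havg : avgFun (expMeanLogSU (n := n)) U c = avgFun (expMeanLogSU (n := n)) U0 c := avgFun_congr₂ _ hj U U0 c hUU0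
  have hsrc : combMean A c.src = combMean A0 c.src := combMean_congr_block hj c.src fun b h1 h2 => hAA0 b (Or.inl h1) (Or.inl h2)
  have htgt : combMean A c.tgt = combMean A0 c.tgt := combMean_congr_block hj c.tgt fun b h1 h2 => hAA0 b (Or.inr h1) (Or.inr h2)
  have hQ : bondAvg A c = bondAvg A0 c := bondAvg_congr₂ hj c hAA0
  rw [havg, hsrc, htgt, hQ]
  exact norm_mlog_combConj_sub_le U0 A0 hξ hr hUA0 hA0r h48 hN c

end LocalCZero

/-! ## §3 The coarse unit difference from the blocks of `c, c′` and the `Le_ν`-differences on the blocks of `c` -/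

section LocalShift

/-- `scale e_ν = L • e_ν` one level down (public twin in the T⁴ `Support` tree, not imported; kept private). [folklore] -/
private theorem scale_unit_shift' (ν : Fin P.d) : Site.scale ((0 : Site P (j + 1)).shift ν) = P.L • (0 : Site P j).shift ν := by
  funext κ
  show Site.scaleCoord P j (((0 : Site P (j + 1)).shift ν) κ) = P.L • (((0 : Site P j).shift ν) κ)
  by_cases h : κ = ν
  · have h1 : ((0 : Site P (j + 1)).shift ν) κ = 1 := by rw [Site.shift_apply, if_pos h, Site.zero_apply, zero_add]
    have h2 : ((0 : Site P j).shift ν) κ = 1 := by rw [Site.shift_apply, if_pos h, Site.zero_apply, zero_add]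
    rw [h1, h2, Site.scaleCoord_one, nsmul_eq_mul, mul_one]
  · have h1 : ((0 : Site P (j + 1)).shift ν) κ = 0 := by rw [Site.shift_apply, if_neg h, Site.zero_apply]
    have h2 : ((0 : Site P j).shift ν) κ = 0 := by rw [Site.shift_apply, if_neg h, Site.zero_apply]
    rw [h1, h2, map_zero, smul_zero]

omit [Fintype n] [DecidableEq n] [Nonempty n] in
/-- Translating a bond by the unit vector `e_ν` shifts its source (`Site.add_zero_shift`). [folklore] -/
private theorem translate_unit_shift' {i : ℕ} (b : PBond P i) (ν : Fin P.d) : b.translate ((0 : Site P i).shift ν) = ⟨b.src.shift ν, b.dir⟩ := by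
  cases b; simp only [PBond.translate, Site.add_zero_shift]

omit [Fintype n] [DecidableEq n] [Nonempty n] in
/-- **Blocks go to blocks under the `Le_ν`-translation**: both ends of `b + Le_ν` lie in the `e_ν`-shifted blocks of the ends of `b` (`blockOf_add_scale`).
[cite: Balaban1987RG1, (2.17) p.269] -/
theorem blockOf_translate_L_shift (hj : j + 1 ≤ P.m + P.K) (b : PBond P j) (ν : Fin P.d) :
    blockOf (b.translate (P.L • (0 : Site P j).shift ν)).src = (blockOf b.src).shift ν ∧
      blockOf (b.translate (P.L • (0 : Site P j).shift ν)).tgt = (blockOf b.tgt).shift ν := by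
  have htgt : (b.translate (P.L • (0 : Site P j).shift ν)).tgt = b.tgt + P.L • (0 : Site P j).shift ν := by
    simp only [PBond.tgt, PBond.translate_src, PBond.translate_dir, Site.shift_add]
  rw [PBond.translate_src, htgt, ← scale_unit_shift', blockOf_add_scale hj, blockOf_add_scale hj, Site.add_zero_shift, Site.add_zero_shift]
  exact ⟨rfl, rfl⟩

/-- ★ **THE COARSE UNIT DIFFERENCE OF THE DOUBLE-BAR REMAINDER, LOCAL**: for `c = ⟨y, μ⟩`, `c′ = ⟨y + e_ν, μ⟩`, if `U_b = exp(iξA_b)` and `‖A_b‖ ≤ r` hold on the bonds with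
both ends in `B(c₋) ∪ B(c₊)` or both in `B(c′₋) ∪ B(c′₊)`, and `‖A(b + Le_ν) − A(b)‖ ≤ ρ_L` on the bonds with both ends in `B(c₋) ∪ B(c₊)` (`48ℓξr ≤ 1`, `4ℓξr < δ_N`), then the
double-bar remainders `log V − iξ′·QA` at `c′` and `c` differ by at most `3200·ℓ²ξ²r·ρ_L` — file 3b's C¹ bound at the DOUBLE CUTOFF (the read-set cutoff of `(U, A)`, and its
`Le_ν`-translate transplanted onto the read set of `c`), all objects reading two blocks and blocks going to blocks. [cite: Balaban1987RG1, (1.12) p.262 and (2.17) p.269; Balaban1985Averaging, (62)-(63) p.28, Prop. 3 (123) p.36] -/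
theorem norm_mlog_combConj_rem_shift_sub_le_local (hj : j + 1 ≤ P.m + P.K) (U : GaugeField P j (Matrix.specialUnitaryGroup n ℂ)) (A : PBond P j → Matrix n n ℂ)
    (y : Site P (j + 1)) (μ ν : Fin P.d) {ξ r ρL : ℝ} (hξ : 0 ≤ ξ) (hr : 0 ≤ r) (hρL : 0 ≤ ρL)
    (hUA : ∀ b : PBond P j,
      ((blockOf b.src = y ∨ blockOf b.src = y.shift μ) ∧ (blockOf b.tgt = y ∨ blockOf b.tgt = y.shift μ)) ∨
        ((blockOf b.src = y.shift ν ∨ blockOf b.src = (y.shift ν).shift μ) ∧ (blockOf b.tgt = y.shift ν ∨ blockOf b.tgt = (y.shift ν).shift μ)) →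
      ((U b : Matrix.specialUnitaryGroup n ℂ) : Matrix n n ℂ) = exp ((Complex.I * ξ : ℂ) • A b))
    (hA : ∀ b : PBond P j,
      ((blockOf b.src = y ∨ blockOf b.src = y.shift μ) ∧ (blockOf b.tgt = y ∨ blockOf b.tgt = y.shift μ)) ∨
        ((blockOf b.src = y.shift ν ∨ blockOf b.src = (y.shift ν).shift μ) ∧ (blockOf b.tgt = y.shift ν ∨ blockOf b.tgt = (y.shift ν).shift μ)) → ‖A b‖ ≤ r)
    (hAL : ∀ b : PBond P j, (blockOf b.src = y ∨ blockOf b.src = y.shift μ) → (blockOf b.tgt = y ∨ blockOf b.tgt = y.shift μ) →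
      ‖A (b.translate (P.L • (0 : Site P j).shift ν)) - A b‖ ≤ ρL)
    (h48 : 48 * ((((P.d + 2) * P.L : ℕ) : ℝ) * (ξ * r)) ≤ 1) (hN : 4 * ((((P.d + 2) * P.L : ℕ) : ℝ) * (ξ * r)) < deltaSU n) :
    ‖(mlog (exp ((Complex.I * ξ : ℂ) • (-combMean A (y.shift ν))) *
              (((avgFun (expMeanLogSU (n := n)) U ⟨y.shift ν, μ⟩ : Matrix.specialUnitaryGroup n ℂ) : Matrix n n ℂ)) *
            exp ((Complex.I * ξ : ℂ) • combMean A ((y.shift ν).shift μ))) - (Complex.I * ξ * P.L : ℂ) • bondAvg A ⟨y.shift ν, μ⟩) -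
        (mlog (exp ((Complex.I * ξ : ℂ) • (-combMean A y)) * (((avgFun (expMeanLogSU (n := n)) U ⟨y, μ⟩ : Matrix.specialUnitaryGroup n ℂ) : Matrix n n ℂ)) *
            exp ((Complex.I * ξ : ℂ) • combMean A (y.shift μ))) - (Complex.I * ξ * P.L : ℂ) • bondAvg A ⟨y, μ⟩)‖ ≤
      3200 * (((P.d + 2) * P.L : ℕ) : ℝ) ^ 2 * ξ ^ 2 * r * ρL := by
  classical
  set a : Site P j := P.L • (0 : Site P j).shift ν with ha
  set Rc : PBond P j → Prop := fun b => (blockOf b.src = y ∨ blockOf b.src = y.shift μ) ∧ (blockOf b.tgt = y ∨ blockOf b.tgt = y.shift μ) with hRc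
  set Rc' : PBond P j → Prop := fun b =>
    (blockOf b.src = y.shift ν ∨ blockOf b.src = (y.shift ν).shift μ) ∧ (blockOf b.tgt = y.shift ν ∨ blockOf b.tgt = (y.shift ν).shift μ) with hRc'
  -- blocks go to blocks
  have hmove : ∀ b, Rc b → Rc' (b.translate a) := by
    intro b hb
    have hbl := blockOf_translate_L_shift hj b ν
    rw [← ha] at hbl
    refine ⟨?_, ?_⟩
    · rw [hbl.1]; rcases hb.1 with h | h <;> rw [h]
      · exact Or.inl rfl
      · exact Or.inr (Site.shift_comm _ _ _)
    · rw [hbl.2]; rcases hb.2 with h | h <;> rw [h]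
      · exact Or.inl rfl
      · exact Or.inr (Site.shift_comm _ _ _)
  -- the first cutoff: `(U, A)` on the two read sets, trivial elsewhere
  set U0 : GaugeField P j (Matrix.specialUnitaryGroup n ℂ) := fun b => if Rc b ∨ Rc' b then U b else 1 with hU0
  set A0 : PBond P j → Matrix n n ℂ := fun b => if Rc b ∨ Rc' b then A b else 0 with hA0
  have hUA0 : ∀ b, ((U0 b : Matrix.specialUnitaryGroup n ℂ) : Matrix n n ℂ) = exp ((Complex.I * ξ : ℂ) • A0 b) := by
    intro b
    by_cases hb : Rc b ∨ Rc' b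
    · simp only [hU0, hA0, if_pos hb]; exact hUA b hb
    · simp only [hU0, hA0, if_neg hb, smul_zero, NormedSpace.exp_zero]; rfl
  have hA0r : ∀ b, ‖A0 b‖ ≤ r := by
    intro b
    by_cases hb : Rc b ∨ Rc' b
    · simp only [hA0, if_pos hb]; exact hA b hb
    · simp only [hA0, if_neg hb, norm_zero]; exact hr
  -- the second cutoff: the `Le_ν`-translate transplanted onto the read set of `c`
  set U1 : GaugeField P j (Matrix.specialUnitaryGroup n ℂ) := fun b => if Rc b then U (b.translate a) else U0 b with hU1
  set A1 : PBond P j → Matrix n n ℂ := fun b => if Rc b then A (b.translate a) else A0 b with hA1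
  have hUA1 : ∀ b, ((U1 b : Matrix.specialUnitaryGroup n ℂ) : Matrix n n ℂ) = exp ((Complex.I * ξ : ℂ) • A1 b) := by
    intro b
    by_cases hb : Rc b
    · simp only [hU1, hA1, if_pos hb]; exact hUA _ (Or.inr (hmove b hb))
    · simp only [hU1, hA1, if_neg hb]; exact hUA0 b
  have hA1r : ∀ b, ‖A1 b‖ ≤ r := by
    intro b
    by_cases hb : Rc b
    · simp only [hA1, if_pos hb]; exact hA _ (Or.inr (hmove b hb))
    · simp only [hA1, if_neg hb]; exact hA0r b
  have hA10 : ∀ b, ‖A1 b - A0 b‖ ≤ ρL := by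
    intro b
    by_cases hb : Rc b
    · simp only [hA1, hA0, if_pos hb, if_pos (Or.inl hb : Rc b ∨ Rc' b)]; exact hAL b hb.1 hb.2
    · simp only [hA1, if_neg hb, sub_self, norm_zero]; exact hρL
  -- (i) the double bar at `c` of the first cutoff IS the double bar at `c`
  have havg0 : avgFun (expMeanLogSU (n := n)) U ⟨y, μ⟩ = avgFun (expMeanLogSU (n := n)) U0 ⟨y, μ⟩ :=
    avgFun_congr₂ _ hj U U0 ⟨y, μ⟩ fun b h1 h2 => by simp only [hU0, if_pos (Or.inl ⟨h1, h2⟩ : Rc b ∨ Rc' b)]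
  have hsrc0 : combMean A y = combMean A0 y :=
    combMean_congr_block hj y fun b h1 h2 => by simp only [hA0, if_pos (Or.inl ⟨Or.inl h1, Or.inl h2⟩ : Rc b ∨ Rc' b)]
  have htgt0 : combMean A (y.shift μ) = combMean A0 (y.shift μ) :=
    combMean_congr_block hj (y.shift μ) fun b h1 h2 => by simp only [hA0, if_pos (Or.inl ⟨Or.inr h1, Or.inr h2⟩ : Rc b ∨ Rc' b)]
  have hQ0 : bondAvg A ⟨y, μ⟩ = bondAvg A0 ⟨y, μ⟩ :=
    bondAvg_congr₂ hj ⟨y, μ⟩ fun b h1 h2 => by simp only [hA0, if_pos (Or.inl ⟨h1, h2⟩ : Rc b ∨ Rc' b)]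
  -- (ii) the double bar at `c` of the second cutoff IS the double bar at `c′`
  have havg1 : avgFun (expMeanLogSU (n := n)) U ⟨y.shift ν, μ⟩ = avgFun (expMeanLogSU (n := n)) U1 ⟨y, μ⟩ := by
    have h := avgFun_translate_apply ((0 : Site P (j + 1)).shift ν) U (⟨y, μ⟩ : PBond P (j + 1))
    rw [translate_unit_shift', scale_unit_shift'] at h
    rw [← h]
    exact avgFun_congr₂ _ hj _ U1 ⟨y, μ⟩ fun b h1 h2 => by
      have hb : Rc b := ⟨h1, h2⟩
      simp only [hU1, hb, if_true, GaugeField.translate_apply, ha]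
  have hsrc1 : combMean A (y.shift ν) = combMean A1 y := by
    rw [← combMean_translate_shift A y ν]
    exact combMean_congr_block hj y fun b h1 h2 => by
      have hb : Rc b := ⟨Or.inl h1, Or.inl h2⟩
      simp only [hA1, hb, if_true, ha]
  have htgt1 : combMean A ((y.shift ν).shift μ) = combMean A1 (y.shift μ) := by
    rw [Site.shift_comm, ← combMean_translate_shift A (y.shift μ) ν]
    exact combMean_congr_block hj (y.shift μ) fun b h1 h2 => by
      have hb : Rc b := ⟨Or.inr h1, Or.inr h2⟩
      simp only [hA1, hb, if_true, ha]
  have hQ1 : bondAvg A ⟨y.shift ν, μ⟩ = bondAvg A1 ⟨y, μ⟩ := by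
    rw [← bondAvg_translate_shift A y μ ν]
    exact bondAvg_congr₂ hj ⟨y, μ⟩ fun b h1 h2 => by
      have hb : Rc b := ⟨h1, h2⟩
      simp only [hA1, hb, if_true, ha]
  rw [havg0, hsrc0, htgt0, hQ0, havg1, hsrc1, htgt1, hQ1]
  exact norm_mlog_combConj_rem_sub_le U1 U0 A1 A0 hξ hr hρL hUA1 hUA0 hA1r hA0r hA10 h48 hN ⟨y, μ⟩

omit [Nonempty n] in
/-- **Telescoping along a caller-supplied bond set**: if the unit `ν`-differences of `A` are `≤ r₁` on every bond of `T` and the `m` successive `e_ν`-translates of `b`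
lie in `T`, then `‖A(b + m·e_ν) − A(b)‖ ≤ m·r₁`. [folklore] -/
theorem norm_translate_sub_le_of_steps (A : PBond P j → Matrix n n ℂ) (ν : Fin P.d) (T : Set (PBond P j)) {r₁ : ℝ}
    (hA₁ : ∀ b ∈ T, ‖A ⟨b.src.shift ν, b.dir⟩ - A b‖ ≤ r₁) :
    ∀ (m : ℕ) (b : PBond P j), (∀ k < m, b.translate (k • (0 : Site P j).shift ν) ∈ T) →
      ‖A (b.translate (m • (0 : Site P j).shift ν)) - A b‖ ≤ m * r₁
  | 0, b, _ => by
    have h0 : b.translate ((0 : ℕ) • (0 : Site P j).shift ν) = b := by cases b; simp [PBond.translate]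
    rw [h0, sub_self, norm_zero, Nat.cast_zero, zero_mul]
  | m + 1, b, hT => by
    have ih := norm_translate_sub_le_of_steps A ν T hA₁ m b fun k hk => hT k (Nat.lt_succ_of_lt hk)
    have hs : b.translate ((m + 1) • (0 : Site P j).shift ν) = (b.translate (m • (0 : Site P j).shift ν)).translate ((0 : Site P j).shift ν) := by
      rw [PBond.translate_translate, succ_nsmul]
    rw [hs]
    have h1 := hA₁ (b.translate (m • (0 : Site P j).shift ν)) (hT m (Nat.lt_succ_self m))
    rw [← translate_unit_shift'] at h1
    calc _ ≤ ‖A ((b.translate (m • (0 : Site P j).shift ν)).translate ((0 : Site P j).shift ν)) - A (b.translate (m • (0 : Site P j).shift ν))‖ +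
            ‖A (b.translate (m • (0 : Site P j).shift ν)) - A b‖ := norm_sub_le_norm_sub_add_norm_sub _ _ _
      _ ≤ r₁ + m * r₁ := add_le_add h1 ih
      _ = ((m + 1 : ℕ) : ℝ) * r₁ := by push_cast; ring

end LocalShift

/-! ## §4 The gauge-clean (1.12) letters, local editions -/

section LocalLetters

/-- ★ **THE SUP LETTER OF THE DOUBLE-BAR POTENTIAL, LOCAL**: `U_b = exp(iξA_b)`, `‖A_b‖ ≤ r` on the bonds with both ends in `B(c₋) ∪ B(c₊)`, and `‖A_b‖ ≤ a` on the `L^{d+1}`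
FEEDING bonds of `c` (`48ℓξr ≤ 1`, `4ℓξr < δ_N`): `‖log V(c)‖ ≤ (Lξ)·a + 2000·ℓ²ξ²r²` — i.e. `|Ā(c)| ≤ |A|_feed + 2000(d+2)²·L·ξ·r²` from TWO BLOCKS of the fine field.
[cite: Balaban1987RG1, (1.12) p.262; Balaban1985Averaging, (93) p.32 and Prop. 3 (123) p.36] -/
theorem norm_mlog_combConj_le_local (hj : j + 1 ≤ P.m + P.K) (U : GaugeField P j (Matrix.specialUnitaryGroup n ℂ)) (A : PBond P j → Matrix n n ℂ)
    (c : PBond P (j + 1)) {ξ r a : ℝ} (hξ : 0 ≤ ξ) (hr : 0 ≤ r)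
    (hUA : ∀ b : PBond P j, (blockOf b.src = c.src ∨ blockOf b.src = c.tgt) → (blockOf b.tgt = c.src ∨ blockOf b.tgt = c.tgt) →
      ((U b : Matrix.specialUnitaryGroup n ℂ) : Matrix n n ℂ) = exp ((Complex.I * ξ : ℂ) • A b))
    (hA : ∀ b : PBond P j, (blockOf b.src = c.src ∨ blockOf b.src = c.tgt) → (blockOf b.tgt = c.src ∨ blockOf b.tgt = c.tgt) → ‖A b‖ ≤ r)
    (ha : ∀ ρ : Fin P.d → Fin P.L, ∀ t < P.L, ‖A (runBond (Site.blockSite c.src ρ) c.dir t)‖ ≤ a)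
    (h48 : 48 * ((((P.d + 2) * P.L : ℕ) : ℝ) * (ξ * r)) ≤ 1) (hN : 4 * ((((P.d + 2) * P.L : ℕ) : ℝ) * (ξ * r)) < deltaSU n) :
    ‖mlog (exp ((Complex.I * ξ : ℂ) • (-combMean A c.src)) * (((avgFun (expMeanLogSU (n := n)) U c : Matrix.specialUnitaryGroup n ℂ) : Matrix n n ℂ)) *
        exp ((Complex.I * ξ : ℂ) • combMean A c.tgt))‖ ≤ P.L * ξ * a + 2000 * (((P.d + 2) * P.L : ℕ) : ℝ) ^ 2 * ξ ^ 2 * r ^ 2 := by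
  set lV := mlog (exp ((Complex.I * ξ : ℂ) • (-combMean A c.src)) * (((avgFun (expMeanLogSU (n := n)) U c : Matrix.specialUnitaryGroup n ℂ) : Matrix n n ℂ)) *
        exp ((Complex.I * ξ : ℂ) • combMean A c.tgt))
  have hQ : ‖bondAvg A c‖ ≤ a := norm_bondAvg_le_of_forall_run (V := Matrix n n ℂ) _ c ha
  have hP := norm_mlog_combConj_sub_le_local hj U A c hξ hr hUA hA h48 hN
  have e : lV = (Complex.I * ξ * P.L : ℂ) • bondAvg A c + (lV - (Complex.I * ξ * P.L : ℂ) • bondAvg A c) := by abel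
  rw [e]
  have hL : ‖(Complex.I * ξ * P.L : ℂ) • bondAvg A c‖ ≤ P.L * ξ * a := by
    rw [norm_smul, norm_mul, norm_mul, Complex.norm_I, one_mul, Complex.norm_real, Real.norm_of_nonneg hξ, Complex.norm_natCast]
    calc ξ * P.L * ‖bondAvg A c‖ ≤ ξ * P.L * a := mul_le_mul_of_nonneg_left hQ (by positivity)
      _ = P.L * ξ * a := by ring
  exact (norm_add_le _ _).trans (add_le_add hL hP)

/-- ★ **THE COARSE-DIFFERENCE LETTER OF THE DOUBLE-BAR POTENTIAL, LOCAL** (`c = ⟨y, μ⟩`, `c′ = ⟨y + e_ν, μ⟩`): with §3's hypotheses on the blocks of `c, c′` (`U = exp(iξA)`,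
`‖A‖ ≤ r`), the `Le_ν`-differences `≤ ρ_L` on the blocks of `c`, and King's (K-b) input — the unit `ν`-differences `≤ r₁` of `A(·, μ)` at the `L^{d+2}` FEEDING sites of `c`:
`‖log V(c′) − log V(c)‖ ≤ (Lξ)·(L·r₁) + 3200·ℓ²ξ²r·ρ_L`; with `ρ_L = L·ξ·t′` and `r₁ = ξ·t′` (`t′ = sup_□|∇^ξ_νA|`) and dividing by `ξ′² = (Lξ)²`:
`|∇^{ξ′}_ν Ā| ≤ t′·(1 + 3200(d+2)²·L·ξr)` FROM THE FINE CUBE ONLY. [cite: Balaban1987RG1, (1.12) p.262; Balaban1985Averaging, (62)-(63) p.28, (93) p.32, Prop. 3 (123) p.36] -/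
theorem norm_shift_sub_mlog_combConj_le_local (hj : j + 1 ≤ P.m + P.K) (U : GaugeField P j (Matrix.specialUnitaryGroup n ℂ)) (A : PBond P j → Matrix n n ℂ)
    (y : Site P (j + 1)) (μ ν : Fin P.d) {ξ r ρL r₁ : ℝ} (hξ : 0 ≤ ξ) (hr : 0 ≤ r) (hρL : 0 ≤ ρL)
    (hUA : ∀ b : PBond P j,
      ((blockOf b.src = y ∨ blockOf b.src = y.shift μ) ∧ (blockOf b.tgt = y ∨ blockOf b.tgt = y.shift μ)) ∨
        ((blockOf b.src = y.shift ν ∨ blockOf b.src = (y.shift ν).shift μ) ∧ (blockOf b.tgt = y.shift ν ∨ blockOf b.tgt = (y.shift ν).shift μ)) →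
      ((U b : Matrix.specialUnitaryGroup n ℂ) : Matrix n n ℂ) = exp ((Complex.I * ξ : ℂ) • A b))
    (hA : ∀ b : PBond P j,
      ((blockOf b.src = y ∨ blockOf b.src = y.shift μ) ∧ (blockOf b.tgt = y ∨ blockOf b.tgt = y.shift μ)) ∨
        ((blockOf b.src = y.shift ν ∨ blockOf b.src = (y.shift ν).shift μ) ∧ (blockOf b.tgt = y.shift ν ∨ blockOf b.tgt = (y.shift ν).shift μ)) → ‖A b‖ ≤ r)
    (hAL : ∀ b : PBond P j, (blockOf b.src = y ∨ blockOf b.src = y.shift μ) → (blockOf b.tgt = y ∨ blockOf b.tgt = y.shift μ) →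
      ‖A (b.translate (P.L • (0 : Site P j).shift ν)) - A b‖ ≤ ρL)
    (hA₁ : ∀ ρ : Fin P.d → Fin P.L, ∀ t < P.L, ∀ s < P.L,
      ‖A ⟨(runSite (runSite (Site.blockSite y ρ) μ t) ν s).shift ν, μ⟩ - A ⟨runSite (runSite (Site.blockSite y ρ) μ t) ν s, μ⟩‖ ≤ r₁)
    (h48 : 48 * ((((P.d + 2) * P.L : ℕ) : ℝ) * (ξ * r)) ≤ 1) (hN : 4 * ((((P.d + 2) * P.L : ℕ) : ℝ) * (ξ * r)) < deltaSU n) :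
    ‖mlog (exp ((Complex.I * ξ : ℂ) • (-combMean A (y.shift ν))) *
            (((avgFun (expMeanLogSU (n := n)) U ⟨y.shift ν, μ⟩ : Matrix.specialUnitaryGroup n ℂ) : Matrix n n ℂ)) *
          exp ((Complex.I * ξ : ℂ) • combMean A ((y.shift ν).shift μ))) -
        mlog (exp ((Complex.I * ξ : ℂ) • (-combMean A y)) * (((avgFun (expMeanLogSU (n := n)) U ⟨y, μ⟩ : Matrix.specialUnitaryGroup n ℂ) : Matrix n n ℂ)) *
          exp ((Complex.I * ξ : ℂ) • combMean A (y.shift μ)))‖ ≤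
      P.L * ξ * (P.L * r₁) + 3200 * (((P.d + 2) * P.L : ℕ) : ℝ) ^ 2 * ξ ^ 2 * r * ρL := by
  set lV1 := mlog (exp ((Complex.I * ξ : ℂ) • (-combMean A (y.shift ν))) *
      (((avgFun (expMeanLogSU (n := n)) U ⟨y.shift ν, μ⟩ : Matrix.specialUnitaryGroup n ℂ) : Matrix n n ℂ)) * exp ((Complex.I * ξ : ℂ) • combMean A ((y.shift ν).shift μ)))
  set lV0 := mlog (exp ((Complex.I * ξ : ℂ) • (-combMean A y)) *
      (((avgFun (expMeanLogSU (n := n)) U ⟨y, μ⟩ : Matrix.specialUnitaryGroup n ℂ) : Matrix n n ℂ)) * exp ((Complex.I * ξ : ℂ) • combMean A (y.shift μ)))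
  have hKb : ‖bondAvg A ⟨y.shift ν, μ⟩ - bondAvg A ⟨y, μ⟩‖ ≤ P.L * r₁ :=
    norm_bondAvg_shift_sub_le_of_forall_run (V := Matrix n n ℂ) hj A y μ ν hA₁
  have hP := norm_mlog_combConj_rem_shift_sub_le_local hj U A y μ ν hξ hr hρL hUA hA hAL h48 hN
  have e : lV1 - lV0 = (Complex.I * ξ * P.L : ℂ) • (bondAvg A ⟨y.shift ν, μ⟩ - bondAvg A ⟨y, μ⟩) +
      ((lV1 - (Complex.I * ξ * P.L : ℂ) • bondAvg A ⟨y.shift ν, μ⟩) - (lV0 - (Complex.I * ξ * P.L : ℂ) • bondAvg A ⟨y, μ⟩)) := by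
    rw [smul_sub]; abel
  rw [e]
  have hL : ‖(Complex.I * ξ * P.L : ℂ) • (bondAvg A ⟨y.shift ν, μ⟩ - bondAvg A ⟨y, μ⟩)‖ ≤ P.L * ξ * (P.L * r₁) := by
    rw [norm_smul, norm_mul, norm_mul, Complex.norm_I, one_mul, Complex.norm_real, Real.norm_of_nonneg hξ, Complex.norm_natCast]
    calc ξ * P.L * ‖bondAvg A ⟨y.shift ν, μ⟩ - bondAvg A ⟨y, μ⟩‖ ≤ ξ * P.L * (P.L * r₁) := mul_le_mul_of_nonneg_left hKb (by positivity)
      _ = P.L * ξ * (P.L * r₁) := by ring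
  exact (norm_add_le _ _).trans (add_le_add hL hP)

end LocalLetters

end YMDAG.N18.AvgPotential
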